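import Literature.AnabelianGeometry.EtaleTheta.SettingModelChiMuTwoInversion
import Literature.AnabelianGeometry.EtaleTheta.SettingModelChiThetaCuspOncePunctured
import Literature.AnabelianGeometry.EtaleTheta.MuTwoSettingPiCData
import Literature.AnabelianGeometry.EtaleTheta.Discharge.Sec2InvEllOfCLevel
import Literature.AnabelianGeometry.EtaleTheta.Discharge.Sec2Prop22InvThetaOfInvEll
import HarnessLib

/-!
# The χ-twisted model WITH A CUSP, file F8ιc: `MuTwoSetting.inversionModelχ′` (`Π^tp_C := Π^tp_X ⋊_ι ℤ/2` over
# `modelχ′`), its C-LEVEL DATA, and the eigenvalue binders hιell / hιtheta of [EtTh] §2 IN CONSUMER FORM at the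
# MuTwoSetting-derived profinite `Π_C ⊇ Π_X ↠ G_K`

S. Mochizuki, *The étale theta function and its Frobenioid-theoretic manifestations*, Publ. RIMS **45** (2009) [EtTh]:
Def. 1.7 p. 27 («`C^log = X^log/±1`», «`ε_± ∈ Gal(Ẍ/C)`»), §1 p. 13 («any decomposition group of a cusp of `Y^log`»),
§2 p. 36 («`Π_X ⊆ Π_C`», «`ι` … “multiplication by `−1`”»), Prop. 2.2 (i) p. 37 («`ι` acts on `Δ̄^ell_X` by `−1` and on
`Δ̄_Θ` by `+1`») [cite: MochizukiEtTh2009, Prop 2.2 (i) p.37]. Layer L2 of the abc-iut cell, seat abc-iut-w5-d140 (gen 4),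
row R290 (i) of abc-iut-L2-lead (gen 4) «hιell at w5-d140's `MuTwoSetting.inversionModelχ` … via
`piCData_inv_ell_of_hinv` + (R1e′)», RESHAPED to the cusped model (STATUS 12:0xZ): abc-iut-L2-t10's reduction
`CLevelData.piCData_inv_ell_of_hinv` (`Discharge/Sec2InvEllOfCLevel`, p432126) needs once-punctured parameters
`(eX : OncePuncturedData)`, which are EMPTY at `modelχ` (`isEmpty_pt_modelχ`) and INHABITED at abc-iut-w5-d029's cusped
twin `ThetaSetting.modelχ′ p` (abc-iut-w5-d111's `nonempty_oncePuncturedData_modelχ'`).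

CONSTRUCTION (class (b), over FROZEN interfaces `MuTwoSetting` / `CLevelData` / `PiCData`; nothing of another seat is
edited or restated — all inputs BY NAME):
* **`MuTwoSetting.inversionModelχ′ p`** — this seat's F8ι carrier `PiCInvχ p = Π^tp_X ⋊_ι ℤ/2` (`invActionχ`, `inclInvχ`,
  `epsPMInvχ`, `epsZInvχ`; abc-iut-f-113's `Xddχ` as `Π^tp_Ẍ`) placed over `toThetaSetting := ThetaSetting.modelχ′ p`
  (SAME `Π^tp_X = Γ ⋊_χ G_{ℚ_p}`, same coverings — `gtpYdd_modelχ_le_Xddχ` applies verbatim, as in abc-iut-w5-d029's F8c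
  `SettingModelChiMuTwoCusp`); `ε_±`-conjugation = the twisted inversion (`inversionModelχ'_epsPM_conj`); the cusp
  (`exists_isCusp_inversionModelχ'`);
* **`CLevelData` for BOTH inversion models** (`cLevelDataInvχ`, `cLevelDataInvχ'`): `inclX` is an OPEN EMBEDDING
  (`isInducing_inclInvχ` + `isOpen_range_inclInvχ`), `augC := aug ∘ left : Π^tp_X ⋊_ι ℤ/2 → G_{ℚ_p}` (`augCInvχ`, a
  homomorphism because `ι` is over `G_K`, `aug_twistedInversion_modelχ`), `augC ∘ inclX = aug`, `range augC = G_K = ⊤`;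
* `conjX_epsPMInvχ'` : the `CLevelData` inner automorphism of `Π^tp_X` by `ε_±` IS `twistedInversionTop (chi p)`;
* **hιell IN CONSUMER FORM** at abc-iut-L2-d3's MuTwoSetting-derived `Π_C`-bundle `(cLevelDataInvχ' p).piCData`
  (`MuTwoSettingPiCData`): `inv_ell_piCData_inversionModelχ'` — by p432126 with `g := ε_±` (`augC ε_± = 1`, `ε_± ∉ Π^tp_X`)
  and (R1e′) `twistedInversion_hinv_modelχ'` (abc-iut-L2-t10, `SettingModelChiCensusClauses`); **hιtheta** by
  abc-iut-L6-d6's `PiCData.inv_theta_of_inv_ell` (`inv_theta_piCData_inversionModelχ'`); census headline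
  `exists_muTwo_cLevel_inv_ell_inv_theta`.
So the route «tempered `Π^tp_C` of a `MuTwoSetting` ⟶ profinite `Π_C` (L2-d3) ⟶ hιell/hιtheta (L2-t10 / L6-d6)» is
exercised END TO END at a Kummer-carrying model with a cusp and a genuine `ε_± = ι` (abc-iut-L2-t10's `piCDataχ'` gave
the same binders for the HAND-BUILT profinite `PiCχ`; here `Π_C` is the one the §1 typing derives from `Π^tp_C`). hIx is
NOT claimed (it FAILS at the toral cusp of `modelχ′`, `not_hIx_modelχ'`).

HONEST FRAMING: SEMI-SYNTHETIC model (the χ-twisted root with the Tate-twisted `b`-axis as its one cusp; not the tempered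
`π₁` of an orbicurve) — consistency / non-vacuity evidence for the typed interface ONLY; nothing of [EtTh] is asserted; no
side is taken on [IUTchIII] Cor. 3.12; typed ≠ proved; instantiated ≠ endorsed. Definitions: `augCInvχ`, the term
`MuTwoSetting.inversionModelχ'`, `cLevelDataInvχ`, `cLevelDataInvχ'` (no instance, no `Prop` fact).
-/

noncomputable section

namespace Literature.AnabelianGeometry.EtaleTheta.SettingModel

open Literature.AnabelianGeometry.SemiGraphs
open _root_.Topology _root_.Function

variable (p : ℕ) [Fact p.Prime]

/-! ### The augmentation `Π^tp_C = Π^tp_X ⋊_ι ℤ/2 → G_{ℚ_p}` -/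

/-- `aug (φ(z) x) = aug x`: the `ℤ/2`-action through `ι` is over `G_{ℚ_p}`. [cite: Mochizuki2012, Rmk 1.4.1 (ii) p.28] -/
theorem augχ_invActionχ (z : Multiplicative (ZMod 2)) (x : PiTpχ p) : augχ p (invActionχ p z x) = augχ p x := by
  rcases invActionχ_eq p z with h | h <;> rw [h]
  · rfl
  · exact aug_twistedInversion_modelχ p x

/-- **`augC : Π^tp_C → G_{ℚ_p}`, `(x, z) ↦ aug x`** — a continuous homomorphism on `Π^tp_X ⋊_ι ℤ/2` (the augmentation of
the orbicurve `C^log` over `K`). DEFINED. [cite: MochizukiEtTh2009, Def 1.7 p.27] -/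
def augCInvχ : PiCInvχ p →ₜ* GQp p where
  toMonoidHom := Semidirect.leftHom (augχ p).toMonoidHom (augχ_invActionχ p)
  continuous_toFun := (augχ p).continuous.comp (Semidirect.continuous_left (isInducing_leftRightCInvχ p))

/-- [cite: MochizukiEtTh2009, Def 1.7 p.27] -/
theorem augCInvχ_apply (g : PiCInvχ p) : augCInvχ p g = augχ p g.left := rfl

/-- `augC ∘ inclX = aug`. [cite: MochizukiEtTh2009, Def 1.7 p.27] -/
theorem augCInvχ_inclInvχ (x : PiTpχ p) : augCInvχ p (inclInvχ p x) = augχ p x := by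
  rw [augCInvχ_apply, inclInvχ, SemidirectProduct.left_inl]

/-- `augC ε_± = 1` (`ε_±` is geometric). [cite: MochizukiEtTh2009, Def 1.7 p.27] -/
theorem augCInvχ_epsPMInvχ : augCInvχ p (epsPMInvχ p) = 1 := by
  rw [augCInvχ_apply, epsPMInvχ, SemidirectProduct.left_inr, map_one]

/-- `augC` is onto `G_{ℚ_p}`. [cite: MochizukiEtTh2009, Def 1.7 p.27] -/
theorem range_augCInvχ : (augCInvχ p).toMonoidHom.range = ⊤ :=
  MonoidHom.range_eq_top.mpr fun σ => ⟨inclInvχ p (SemidirectProduct.inr σ), rfl⟩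

/-- `ε_± ∉ inclX(Π^tp_X)`. [cite: MochizukiEtTh2009, Def 1.7 p.27] -/
theorem epsPMInvχ_not_mem_range : epsPMInvχ p ∉ (inclInvχ p).range := (MuTwoSetting.inversionModelχ p).epsPM_not_mem

/-- `inclX : Π^tp_X ↪ Π^tp_C` is an OPEN EMBEDDING. [cite: MochizukiEtTh2009, Def 1.7 p.27] -/
theorem isOpenEmbedding_inclInvχ : IsOpenEmbedding (inclInvχ p) :=
  ⟨⟨isInducing_inclInvχ p, SemidirectProduct.inl_injective⟩, isOpen_range_inclInvχ p⟩

/-! ### The cusped inversion model -/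

/-- **The inversion model of [EtTh] Def. 1.7 over the χ-twisted root WITH A CUSP**: `MuTwoSetting.inversionModelχ`'s
carrier (`Π^tp_C := Π^tp_X ⋊_ι ℤ/2`, `Π^tp_Ẍ := Xddχ`, `ε_μ := b`, `ε_± := (1, 1̄)`, `ε_Z := a`) over
`ThetaSetting.modelχ′ p` (one synthetic cusp with decomposition group `b^Ẑ ⋊ G_{ℚ_p}`). Semi-synthetic; consistency evidence
only. DEFINED. [cite: MochizukiEtTh2009, Def 1.7 p.27] -/
abbrev _root_.Literature.AnabelianGeometry.EtaleTheta.MuTwoSetting.inversionModelχ' : MuTwoSetting p where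
  toThetaSetting := ThetaSetting.modelχ' p
  sqrtqX_mem_K := (MuTwoSetting.modelχ p).sqrtqX_mem_K
  GtpC := PiCInvχ p
  inclX := inclInvχ p
  continuous_inclX := continuous_inclInvχ p
  injective_inclX := SemidirectProduct.inl_injective
  isOpen_range_inclX := isOpen_range_inclInvχ p
  range_inclX_normal := (MuTwoSetting.inversionModelχ p).range_inclX_normal
  index_range_inclX := (MuTwoSetting.inversionModelχ p).index_range_inclX
  GtpXdd := Xddχ p
  index_GtpXdd := index_Xddχ p
  map_GtpXdd_normal := map_inclInvχ_Xddχ_normal p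
  sq_mem_GtpXdd := (MuTwoSetting.inversionModelχ p).sq_mem_GtpXdd
  GtpYdd_le_GtpXdd := gtpYdd_modelχ_le_Xddχ p
  epsMu := inclInvχ p (SemidirectProduct.inl (gfpOf (FreeGroup.of 1)))
  epsMu_mem := ⟨_, rfl⟩
  epsMu_not_mem := (MuTwoSetting.inversionModelχ p).epsMu_not_mem
  epsPM := epsPMInvχ p
  epsPM_not_mem := (MuTwoSetting.inversionModelχ p).epsPM_not_mem

/-- The cusped inversion model sits over `modelχ′`. [cite: MochizukiEtTh2009, Def 1.7 p.27] -/
theorem _root_.Literature.AnabelianGeometry.EtaleTheta.MuTwoSetting.inversionModelχ'_toThetaSetting :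
    (MuTwoSetting.inversionModelχ' p).toThetaSetting = ThetaSetting.modelχ' p := rfl

/-- … with the SAME `Π^tp_C`, `inclX`, `Π^tp_Ẍ`, `ε_μ`, `ε_±` as `MuTwoSetting.inversionModelχ`. [cite: MochizukiEtTh2009, Def 1.7 p.27] -/
theorem _root_.Literature.AnabelianGeometry.EtaleTheta.MuTwoSetting.inversionModelχ'_GtpC_inclX :
    (MuTwoSetting.inversionModelχ' p).GtpC = (MuTwoSetting.inversionModelχ p).GtpC ∧
      HEq (MuTwoSetting.inversionModelχ' p).inclX (MuTwoSetting.inversionModelχ p).inclX ∧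
      HEq (MuTwoSetting.inversionModelχ' p).GtpXdd (MuTwoSetting.inversionModelχ p).GtpXdd ∧
      HEq (MuTwoSetting.inversionModelχ' p).epsPM (MuTwoSetting.inversionModelχ p).epsPM :=
  ⟨rfl, HEq.rfl, HEq.rfl, HEq.rfl⟩

/-- … hence satisfies the guard `IsEtThOrigin`. [cite: MochizukiEtTh2009, §1 p.12] -/
theorem _root_.Literature.AnabelianGeometry.EtaleTheta.MuTwoSetting.inversionModelχ'_isEtThOrigin :
    (MuTwoSetting.inversionModelχ' p).toThetaSetting.IsEtThOrigin :=
  ThetaSetting.modelχ'_isEtThOrigin p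

/-- … and `Compat`. [cite: MochizukiEtTh2009, Prop 1.5 p.22] -/
theorem _root_.Literature.AnabelianGeometry.EtaleTheta.MuTwoSetting.inversionModelχ'_compat :
    (MuTwoSetting.inversionModelχ' p).toThetaSetting.Compat :=
  (ThetaSetting.modelχ' p).compat

/-- **`ε_Z := a` is admissible** (same carrier, same parities as at `inversionModelχ`). [cite: MochizukiEtTh2009, Def 1.7 p.27] -/
theorem _root_.Literature.AnabelianGeometry.EtaleTheta.MuTwoSetting.inversionModelχ'_isAdmissibleEpsZ :
    (MuTwoSetting.inversionModelχ' p).IsAdmissibleEpsZ (epsZInvχ p) :=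
  MuTwoSetting.inversionModelχ_isAdmissibleEpsZ p

/-- **`ε_± · inclX x · ε_±⁻¹ = inclX (ι x)`** at the cusped inversion model. [cite: MochizukiEtTh2009, §2 p.36] -/
theorem _root_.Literature.AnabelianGeometry.EtaleTheta.MuTwoSetting.inversionModelχ'_epsPM_conj (x : PiTpχ p) :
    (MuTwoSetting.inversionModelχ' p).epsPM * (MuTwoSetting.inversionModelχ' p).inclX x *
        (MuTwoSetting.inversionModelχ' p).epsPM⁻¹ =
      (MuTwoSetting.inversionModelχ' p).inclX (twistedInversionTop (chi p) (isInducing_leftRightχ p) x) :=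
  epsPM_conj_inlχ p x

/-- **The model has a cusp** (abc-iut-w5-d029's synthetic cusp of `curveχ′`). [cite: MochizukiEtTh2009, §1 p.13] -/
theorem _root_.Literature.AnabelianGeometry.EtaleTheta.MuTwoSetting.exists_isCusp_inversionModelχ' :
    ∃ x : (MuTwoSetting.inversionModelχ' p).Pt, (MuTwoSetting.inversionModelχ' p).IsCusp x :=
  ⟨(), trivial⟩

/-! ### C-level data for the inversion models -/

/-- `G_K = G_{ℚ_p}` at `modelχ′` (`K = ℚ_p`). [cite: MochizukiEtTh2009, §1 p.12] -/
theorem GK_modelχ' : (ThetaSetting.modelχ' p).GK = ⊤ :=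
  IntermediateField.fixingSubgroup_bot

/-- **C-level data for `MuTwoSetting.inversionModelχ`** (abc-iut-L2-d3's `CLevelData`): `inclX` an open embedding,
`augC := aug ∘ left`. DEFINED. [cite: MochizukiEtTh2009, Def 1.7 p.27] -/
def cLevelDataInvχ : (MuTwoSetting.inversionModelχ p).CLevelData where
  isOpenEmbedding_inclX := isOpenEmbedding_inclInvχ p
  augC := augCInvχ p
  augC_inclX := augCInvχ_inclInvχ p
  range_augC := by
    rw [range_augCInvχ]
    exact (IntermediateField.fixingSubgroup_bot (F := ℚ_[p]) (E := PadicAlgCl p)).symm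

/-- **C-level data for the CUSPED `MuTwoSetting.inversionModelχ′`** (same fields). DEFINED. [cite: MochizukiEtTh2009, Def 1.7 p.27] -/
def cLevelDataInvχ' : (MuTwoSetting.inversionModelχ' p).CLevelData where
  isOpenEmbedding_inclX := isOpenEmbedding_inclInvχ p
  augC := augCInvχ p
  augC_inclX := augCInvχ_inclInvχ p
  range_augC := by rw [range_augCInvχ]; exact (GK_modelχ' p).symm

/-- Census: `CLevelData` is inhabited over a Kummer-carrying `MuTwoSetting` with a genuine `ε_± = ι` (both twins).
[cite: MochizukiEtTh2009, Def 1.7 p.27] -/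
theorem nonempty_cLevelData_inversionModelχ :
    Nonempty (MuTwoSetting.inversionModelχ p).CLevelData ∧ Nonempty (MuTwoSetting.inversionModelχ' p).CLevelData :=
  ⟨⟨cLevelDataInvχ p⟩, ⟨cLevelDataInvχ' p⟩⟩

/-- **The `CLevelData` inner automorphism of `Π^tp_X` by `ε_±` IS the twisted inversion** (cusped model).
[cite: MochizukiEtTh2009, §2 p.36] -/
theorem conjX_epsPMInvχ' :
    (cLevelDataInvχ' p).conjX (epsPMInvχ p) = twistedInversionTop (chi p) (isInducing_leftRightχ p) := by
  refine ContinuousMulEquiv.ext fun x => (MuTwoSetting.inversionModelχ' p).injective_inclX ?_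
  have h := (cLevelDataInvχ' p).inclX_conjX (epsPMInvχ p) x
  change inclInvχ p _ = epsPMInvχ p * inclInvχ p x * (epsPMInvχ p)⁻¹ at h
  rw [epsPM_conj_inlχ] at h
  exact h

/-- The same at the non-cusped model. [cite: MochizukiEtTh2009, §2 p.36] -/
theorem conjX_epsPMInvχ :
    (cLevelDataInvχ p).conjX (epsPMInvχ p) = twistedInversionTop (chi p) (isInducing_leftRightχ p) := by
  refine ContinuousMulEquiv.ext fun x => (MuTwoSetting.inversionModelχ p).injective_inclX ?_
  have h := (cLevelDataInvχ p).inclX_conjX (epsPMInvχ p) x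
  change inclInvχ p _ = epsPMInvχ p * inclInvχ p x * (epsPMInvχ p)⁻¹ at h
  rw [epsPM_conj_inlχ] at h
  exact h

/-- **(R1e′) for the `ε_±`-conjugation of the C-level data** (cusped model): `ε̂_± y · y ∈ ⁅Δ̂_X, Δ̂_X⁆⁻` for every
`y ∈ Δ̂_X` (abc-iut-L2-t10's `twistedInversion_hinv_modelχ'`). [cite: MochizukiEtTh2009, Prop 2.2 (i) p.37] -/
theorem hinv_conjX_epsPMInvχ' :
    ∀ y ∈ (MuTwoSetting.inversionModelχ' p).DeltaHat,
      (MuTwoSetting.inversionModelχ' p).completionAut ((cLevelDataInvχ' p).conjX (epsPMInvχ p)) y * y ∈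
        (⁅(MuTwoSetting.inversionModelχ' p).DeltaHat, (MuTwoSetting.inversionModelχ' p).DeltaHat⁆).topologicalClosure := by
  rw [conjX_epsPMInvχ']
  exact twistedInversion_hinv_modelχ' p

/-! ### hιell and hιtheta IN CONSUMER FORM at the MuTwoSetting-derived `Π_C` -/

/-- **hιell at `(cLevelDataInvχ' p).piCData`** — «`ι` acts on `Δ̄^ell_X` by `−1`» for EVERY `c ∈ Ker(Π_C ↠ G_K) ∖ Π_X`
and `d ∈ Π_X ∩ Ker` (the binder of `PiCData.coverDataAx`), by abc-iut-L2-t10's `CLevelData.piCData_inv_ell_of_hinv`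
with `g := ε_±` and abc-iut-w5-d111's once-punctured parameters of `modelχ′`. [cite: MochizukiEtTh2009, Prop 2.2 (i) p.37] -/
theorem inv_ell_piCData_inversionModelχ' (l : ℕ) (eX : (ThetaSetting.modelχ' p).OncePuncturedData) :
    ∀ c ∈ (cLevelDataInvχ' p).piCData.augGK.ker, c ∉ (cLevelDataInvχ' p).piCData.PiX →
      ∀ d ∈ (cLevelDataInvχ' p).piCData.PiX ⊓ (cLevelDataInvχ' p).piCData.augGK.ker,
        c * d * c⁻¹ * d ∈ (cLevelDataInvχ' p).piCData.barTheta l :=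
  (cLevelDataInvχ' p).piCData_inv_ell_of_hinv eX l (g := epsPMInvχ p) (augCInvχ_epsPMInvχ p)
    (epsPMInvχ_not_mem_range p) (hinv_conjX_epsPMInvχ' p)

/-- **hιtheta at the same datum** — «`ι` acts on `Δ̄_Θ` by `+1`», from hιell by abc-iut-L6-d6's
`PiCData.inv_theta_of_inv_ell`. [cite: MochizukiEtTh2009, Prop 2.2 (i) p.37] -/
theorem inv_theta_piCData_inversionModelχ' (l : ℕ) (eX : (ThetaSetting.modelχ' p).OncePuncturedData) :
    ∀ c ∈ (cLevelDataInvχ' p).piCData.augGK.ker, c ∉ (cLevelDataInvχ' p).piCData.PiX →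
      ∀ t ∈ (cLevelDataInvχ' p).piCData.barTheta l,
        c * t * c⁻¹ * t⁻¹ ∈ (cLevelDataInvχ' p).piCData.barKer l :=
  (cLevelDataInvχ' p).piCData.inv_theta_of_inv_ell l eX (inv_ell_piCData_inversionModelχ' p l eX)

/-- **CENSUS HEADLINE (R290 (i)).** There are a Def. 1.7 setting `M` (guard `IsEtThOrigin`, admissible `ε_Z`, A CUSP, and
`ε_±` REALISING a topological inversion `ι` of `Π^tp_X` by conjugation), C-level data `e : M.CLevelData` and
once-punctured parameters such that at the DERIVED profinite bundle `e.piCData : PiCData` (abc-iut-L2-d3) the two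
eigenvalue binders hιell and hιtheta of `PiCData.coverDataAx` HOLD — witness the cusped inversion model over `modelχ′`.
[cite: MochizukiEtTh2009, Prop 2.2 (i) p.37] -/
theorem _root_.Literature.AnabelianGeometry.EtaleTheta.MuTwoSetting.exists_muTwo_cLevel_inv_ell_inv_theta (l : ℕ) :
    ∃ (M : MuTwoSetting p) (e : M.CLevelData) (_ : M.toThetaSetting.OncePuncturedData),
      M.toThetaSetting.IsEtThOrigin ∧ (∃ εZ : M.GtpC, M.IsAdmissibleEpsZ εZ) ∧ (∃ x : M.Pt, M.IsCusp x) ∧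
      (∃ ι : M.PiTemp ≃ₜ* M.PiTemp, ∀ x, M.inclX (ι x) = M.epsPM * M.inclX x * M.epsPM⁻¹) ∧
      (∀ c ∈ e.piCData.augGK.ker, c ∉ e.piCData.PiX →
        ∀ d ∈ e.piCData.PiX ⊓ e.piCData.augGK.ker, c * d * c⁻¹ * d ∈ e.piCData.barTheta l) ∧
      (∀ c ∈ e.piCData.augGK.ker, c ∉ e.piCData.PiX →
        ∀ t ∈ e.piCData.barTheta l, c * t * c⁻¹ * t⁻¹ ∈ e.piCData.barKer l) := by
  obtain ⟨eX⟩ := nonempty_oncePuncturedData_modelχ' p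
  exact ⟨MuTwoSetting.inversionModelχ' p, cLevelDataInvχ' p, eX, MuTwoSetting.inversionModelχ'_isEtThOrigin p,
    ⟨_, MuTwoSetting.inversionModelχ'_isAdmissibleEpsZ p⟩, MuTwoSetting.exists_isCusp_inversionModelχ' p,
    ⟨twistedInversionTop (chi p) (isInducing_leftRightχ p), fun x => (epsPM_conj_inlχ p x).symm⟩,
    inv_ell_piCData_inversionModelχ' p l eX, inv_theta_piCData_inversionModelχ' p l eX⟩

end Literature.AnabelianGeometry.EtaleTheta.SettingModel

end
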